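import Summits.BirchSwinnertonDyer.Rank1Residual.X11b.BDPRouteShaAn
import Literature.NumberTheory.EllipticCurves.VariableChangePointsMap
import Literature.NumberTheory.EllipticCurves.BSDInvariantsRegulatorProofs
import Literature.NumberTheory.EllipticCurves.BSDInvariantsProofs
import Literature.NumberTheory.EllipticCurves.ComplexMultiplicationBurungaleFlachProofs
import Literature.NumberTheory.EllipticCurves.RegulatorProofs
import Literature.NumberTheory.EllipticCurves.MordellWeilRankZeroProofs
import HarnessLib

/-!
# The anticyclotomic (Heegner / BDP) road in analytic rank ZERO — transport lemmas: over
# `K = ℚ(√d_K)` the twist `E^{(d_K)}` is `K`-isomorphic to `E`; heights, index, torsion, `L'(E/K,1)`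
# (cell `bsd-print-x6`, prover p3 «anticyclotomic road», leaf ClassX6 ∧ r_an = 0)

HONEST FRAMING. Cell `bsd-print-x6` (HOME `run/shared/lean/pub/bsd-print-x6/`, D-0131 (2) PRINT
TIER, leaf `ClassX6 W p ∧ W.analyticRank = 0`). Prover p3's strategy sentence: «anticyclotomic road:
Heegner `K` with `p` split, BDP main conjecture at supersingular `p` + a twist certificate ⇒
BSD_p(E/K) ⇒ BSD_p(E)». THEOREMS ONLY (no definition, no named fact, no `sorry`); elementary
transport lemmas (Silverman AEC III.3.1(b), VIII.9.1, X.5 Cor. 5.4, Ex. 10.16) serving the rank-ZERO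
mirror of the tree's rank-one Gross–Zagier bookkeeping `X11b.exists_shaAn_padicVal_eq_of_heegner`
(companion file `PrintX6AnticyclotomicRankZeroShaAn.lean`): in rank zero the free part of `E(K)` is
the TWIST's, so the Kriz–Li §2 height–index lemma (stated in the tree for `rank E(ℚ) = 1`) is
transported along the `K`-isomorphism `E_K ≅ E^{(d_K)}_K`. Nothing about any curve is asserted;
nothing is booked; PARTITION: 0 cells move; beyond-print theorem: NO.

* `exists_variableChange_baseChange_eq_twist_baseChange` — `C • W_K = Wd_K` for any `ℚ`-model `Wd` of
  `W^{(d_K)}` (composition of the tree's `exists_variableChange_quadraticTwist_one`, `twistUntwist`,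
  `exists_variableChange_quadraticTwist_mul_sq`).
* `exists_mul_canonicalHeight_eq_index_sq_mul_regulator_twist` — `rank E(K) = rank E^{(d_K)}(ℚ) = 1`,
  `P ∈ E(K)` of infinite order ⇒ `m · #E(K)_tors² · ĥ_K(P) = 2·[E(K):ℤP]²·Reg(E^{(d_K)}/ℚ)`, `m ∈ {1,4}`.
* `padicValNat_torsionOrder_baseChange_quadratic_anyRank` — `v_p #E(K)_tors = v_p #E(F)_tors +
  v_p #E^{(d)}(F)_tors` at odd `p`, any ranks.
* `lDerivEK_eq_mul_deriv` — `L'(E/K,1) = L(E,1)·L'(E^{(d_K)},1)` when `L(E^{(d_K)},1) = 0`.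

References: [SilvermanAEC2009] III.3.1(b), VIII.9.1, X.5 Cor. 5.4, Ex. 10.16; [GrossZagier1986] V.§1
(p. 308), V.§2 (p. 311); [Gross1991] §1.
-/

set_option linter.dupNamespace false
set_option autoImplicit false

noncomputable section

open scoped Classical

open WeierstrassCurve NumberField Literature.NumberTheory.EllipticCurves
  Literature.NumberTheory.EllipticCurves.ModularForms
  Literature.NumberTheory.EllipticCurves.KrizLi2019

namespace Summit.BirchSwinnertonDyer.BirchSwinnertonDyer.Theorems.AnticyclotomicRankZero

/-! ### §1 The twist is `K`-isomorphic to the curve; transport of heights, index, torsion -/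

/-- **Over `K = ℚ(√d_K)` the quadratic twist by `d_K` is `K`-isomorphic to the curve**: for `W/ℚ`,
`K` quadratic and any `ℚ`-model `Wd = Cd • W^{(d_K)}` there is a change of variables `C` over `K`
with `C • W_K = Wd_K`. Composition of tree isomorphisms: `W ≅ W^{(1)}` (completing the square,
`exists_variableChange_quadraticTwist_one`), `W^{(c)}_K ≅ W^{(1)}_K` by `u = θ = √c`
(`twistUntwist_smul_baseChange`, Silverman AEC X.5 Cor. 5.4), `W^{(c q²)} ≅ W^{(c)}`
(`exists_variableChange_quadraticTwist_mul_sq`, `d_K = c q²` by `NumberField.exists_discr_eq_mul_sq`),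
and `Cd`. [cite: SilvermanAEC2009, X.5 Cor. 5.4 and III.3.1(b)] -/
theorem exists_variableChange_baseChange_eq_twist_baseChange
    (W : WeierstrassCurve ℚ) (K : Type) [Field K] [NumberField K]
    (h2 : Module.finrank ℚ K = 2) (Wd : WeierstrassCurve ℚ)
    (hWd : ∃ C : VariableChange ℚ, C • W.quadraticTwist (NumberField.discr K : ℚ) = Wd) :
    ∃ C : VariableChange K, C • W.baseChange K = Wd.baseChange K := by
  obtain ⟨θ, c, hθ, hc⟩ :=
    Literature.NumberTheory.QuadraticFields.Quadratic.exists_sq_eq_algebraMap (F := ℚ) (K := K) h2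
  obtain ⟨q, hq, hd⟩ := NumberField.exists_discr_eq_mul_sq h2 hθ hc
  obtain ⟨C₁, hC₁⟩ := W.exists_variableChange_quadraticTwist_mul_sq c q hq
  rw [← hd] at hC₁
  obtain ⟨Cd, hCd⟩ := hWd
  obtain ⟨C₀, hC₀⟩ := W.exists_variableChange_quadraticTwist_one
  haveI : NeZero (2 : ℚ) := ⟨two_ne_zero⟩
  have hT := twistUntwist_smul_baseChange W hθ hc
  refine ⟨Cd.map (algebraMap ℚ K) * C₁.map (algebraMap ℚ K) * (twistUntwist hθ)⁻¹ *
    C₀.map (algebraMap ℚ K), ?_⟩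
  rw [mul_smul, mul_smul, mul_smul, ← VariableChange.baseChange_smul_eq W C₀ K, hC₀, ← hT,
    inv_smul_smul, ← VariableChange.baseChange_smul_eq (W.quadraticTwist c) C₁ K, hC₁,
    ← VariableChange.baseChange_smul_eq _ Cd K, hCd]

/-- `ĥ` is unchanged by the transport along an equality of Weierstrass equations (the identity on
coordinates). [folklore] -/
private theorem canonicalHeight_congrEquiv' {L : Type} [Field L] [NumberField L]
    {W₁ W₂ : WeierstrassCurve L} (h : W₁ = W₂) (P : W₁.toAffine.Point) :
    (Affine.Point.congrEquiv h P).canonicalHeight = P.canonicalHeight := by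
  subst h
  rfl

/-- **Height–index relation when the free part of `E(K)` comes from the twist.** `W/ℚ` elliptic,
`K/ℚ` quadratic, `Wd` a `ℚ`-model of `W^{(d_K)}`, `rank E(K) = 1 = rank Wd(ℚ)`, `P ∈ E(K)` of
infinite order ⇒ `m · #E(K)_tors² · ĥ_K(P) = 2 · [E(K):ℤP]² · Reg(Wd/ℚ)` for some `m ∈ {1, 4}`.
Proof: transport along the `K`-isomorphism `e : E(K) ≃+ Wd(K)` of
`exists_variableChange_baseChange_eq_twist_baseChange` (`ĥ(eP) = ĥ(P)`:
`Affine.Point.canonicalHeight_pointEquiv`, Silverman AEC VIII.9.1; index, torsion order and rank are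
isomorphism invariants: `AddSubgroup.index_map_of_bijective`, `torsionOrder_variableChange_holds`,
`mordellWeilRank_variableChange_holds`) and the tree's Kriz–Li §2 lemma
`exists_mul_canonicalHeight_eq_index_sq_mul_regulator` for `Wd` (`rank Wd(K) = rank Wd(ℚ) = 1`).
This is Gross–Zagier 1986 V.§2 (p. 311) "`ĥ(P_K) = [E(K):ℤP_K]² ·` regulator" in the configuration
`rank E(ℚ) = 0` (Gross 1991 §1). [cite: GrossZagier1986, V.§2 (p. 311)] [cite: SilvermanAEC2009, Prop. VIII.9.1 and X.5 Cor. 5.4] -/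
theorem exists_mul_canonicalHeight_eq_index_sq_mul_regulator_twist
    (W : WeierstrassCurve ℚ) [W.IsElliptic] (K : Type) [Field K] [NumberField K]
    (h2 : Module.finrank ℚ K = 2) (Wd : WeierstrassCurve ℚ) [Wd.IsElliptic]
    (hWd : ∃ C : VariableChange ℚ, C • W.quadraticTwist (NumberField.discr K : ℚ) = Wd)
    (hrK : (W.baseChange K).mordellWeilRank = 1) (hrd : Wd.mordellWeilRank = 1)
    (P : (W.baseChange K).toAffine.Point) (hP : ¬ IsOfFinAddOrder P) :
    ∃ m : ℕ, (m = 1 ∨ m = 4) ∧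
      (m : ℝ) * ((W.baseChange K).torsionOrder : ℝ) ^ 2 * P.canonicalHeight =
        2 * ((AddSubgroup.zmultiples P).index : ℝ) ^ 2 * Wd.regulator := by
  haveI hEK : (W.baseChange K).IsElliptic := isElliptic_baseChange' W K
  haveI hEdK : (Wd.baseChange K).IsElliptic := isElliptic_baseChange' Wd K
  obtain ⟨C, hC⟩ := exists_variableChange_baseChange_eq_twist_baseChange W K h2 Wd hWd
  -- the transport `e : W(K) ≃+ Wd(K)`
  set e : (W.baseChange K).toAffine.Point ≃+ (Wd.baseChange K).toAffine.Point :=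
    (VariableChange.pointEquiv (W.baseChange K) C).trans (Affine.Point.congrEquiv hC) with he
  -- invariants along `C`
  have hrK' : (Wd.baseChange K).mordellWeilRank = 1 := by
    rw [← hC]; exact (mordellWeilRank_variableChange_holds (W.baseChange K) C).trans hrK
  have htors : (Wd.baseChange K).torsionOrder = (W.baseChange K).torsionOrder := by
    rw [← hC]; exact torsionOrder_variableChange_holds (W.baseChange K) C
  have hheight : (e P).canonicalHeight = P.canonicalHeight := by
    rw [he, AddEquiv.trans_apply, canonicalHeight_congrEquiv', VariableChange.pointEquiv_apply]
    have h := Affine.Point.canonicalHeight_pointEquiv (W := W.baseChange K) C P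
    rwa [VariableChange.pointEquiv_apply] at h
  have hindex : (AddSubgroup.zmultiples (e P)).index = (AddSubgroup.zmultiples P).index := by
    have hmap : AddSubgroup.zmultiples (e P) = (AddSubgroup.zmultiples P).map e.toAddMonoidHom := by
      rw [AddMonoidHom.map_zmultiples]; rfl
    rw [hmap]
    exact AddSubgroup.index_map_of_bijective e.bijective _
  have hP' : ¬ IsOfFinAddOrder (e P) := by
    intro h
    apply hP
    have := e.symm.toAddMonoidHom.isOfFinAddOrder h
    simpa using this
  obtain ⟨m, hm, hh⟩ :=
    exists_mul_canonicalHeight_eq_index_sq_mul_regulator Wd K h2 hrK' hrd (e P) hP'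
  refine ⟨m, hm, ?_⟩
  rw [hheight, hindex, htors] at hh
  exact hh

/-- **The odd part of the torsion under quadratic base change, in valuations, ANY ranks**: for
`K = F(θ)`, `θ² = c`, an `F`-model `Wd` of `W^{(d)}`, `d = c q²`, and an odd prime `p`:
`v_p #E(K)_tors = v_p #E(F)_tors + v_p #Wd(F)_tors` (`E(K)[p^∞] ≅ E(F)[p^∞] × Wd(F)[p^∞]`, tree
theorem `card_primaryComponent_point_baseChange_quadratic_of_odd`, read on the (finite) torsion
subgroups via `natCard_primaryComponent_eq_pow_padicValNat_torsion`). The tree's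
`padicValNat_torsionOrder_baseChange_quadratic` is the case `Wd(F)` finite. [cite: SilvermanAEC2009, Exercise 10.16] -/
theorem padicValNat_torsionOrder_baseChange_quadratic_anyRank
    {F : Type} [Field F] [NumberField F] (W : WeierstrassCurve F) [W.IsElliptic]
    (K : Type) [Field K] [NumberField K] [Algebra F K]
    (h2 : Module.finrank F K = 2)
    {θ : K} {c : F} (hθ : θ ∉ Set.range (algebraMap F K)) (hc : θ ^ 2 = algebraMap F K c)
    {d q : F} (hq : q ≠ 0) (hd : d = c * q ^ 2)
    {Wd : WeierstrassCurve F} [Wd.IsElliptic]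
    (hWd : ∃ C : VariableChange F, C • W.quadraticTwist d = Wd)
    (p : ℕ) [Fact p.Prime] (hp : p ≠ 2) :
    padicValNat p (W.baseChange K).torsionOrder =
      padicValNat p W.torsionOrder + padicValNat p Wd.torsionOrder := by
  haveI : NeZero (2 : F) := ⟨two_ne_zero⟩
  haveI : (W.baseChange K).IsElliptic := isElliptic_baseChange' W K
  haveI : Finite (AddCommGroup.torsion W.toAffine.Point) := W.finite_torsion_holds
  haveI : Finite (AddCommGroup.torsion Wd.toAffine.Point) := Wd.finite_torsion_holds
  haveI : Finite (AddCommGroup.torsion (W.baseChange K).toAffine.Point) :=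
    (W.baseChange K).finite_torsion_holds
  have hcard := card_primaryComponent_point_baseChange_quadratic_of_odd W h2 hθ hc hq hd hWd
    (W' := W.baseChange K) ⟨1, one_smul _ _⟩ p hp
  rw [natCard_primaryComponent_eq_pow_padicValNat_torsion p,
    natCard_primaryComponent_eq_pow_padicValNat_torsion p,
    natCard_primaryComponent_eq_pow_padicValNat_torsion p, ← pow_add] at hcard
  exact Nat.pow_right_injective (Fact.out : p.Prime).two_le hcard

/-! ### §2 `L`-values: the product rule when the twist vanishes -/

/-- **Product rule for `L'(E/K, 1)` when the TWIST vanishes at `1`**: with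
`L(E/K, s) = L(E, s) · L(E^{(d_K)}, s)` (the tree's `LDerivEK`) and `L(E^{(d_K)}, 1) = 0`,
`L'(E/K, 1) = L(E, 1) · L'(E^{(d_K)}, 1)` (Gross–Zagier 1986 V.§1 p. 308 "`L'(f,1)L_ε(f,1) =
L'(f,1,1)`", with the roles of `f` and `f ⊗ ε` exchanged); modularity (`hmod`) supplies the
differentiability. Mirror of the tree's `KrizLi2019.lDerivEK_eq_deriv_mul`. [cite: GrossZagier1986, V.§1 (p. 308)] -/
theorem lDerivEK_eq_mul_deriv (hmod : hasEntireLFunction_rat) (W : WeierstrassCurve ℚ) [W.IsElliptic]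
    (K : Type) [Field K] [NumberField K]
    (h0 : (W.quadraticTwist (NumberField.discr K : ℚ)).entireLFunction 1 = 0) :
    LDerivEK W K =
      W.entireLFunction 1 * deriv (W.quadraticTwist (NumberField.discr K : ℚ)).entireLFunction 1 := by
  have hD : (NumberField.discr K : ℚ) ≠ 0 := by exact_mod_cast NumberField.discr_ne_zero K
  haveI := W.isElliptic_quadraticTwist hD
  have hf : DifferentiableAt ℂ W.entireLFunction 1 :=
    (W.differentiable_entireLFunction (hmod W)).differentiableAt
  have hg : DifferentiableAt ℂ (W.quadraticTwist (NumberField.discr K : ℚ)).entireLFunction 1 :=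
    ((W.quadraticTwist _).differentiable_entireLFunction (hmod _)).differentiableAt
  unfold LDerivEK
  rw [deriv_fun_mul hf hg, h0, mul_zero, zero_add]

end Summit.BirchSwinnertonDyer.BirchSwinnertonDyer.Theorems.AnticyclotomicRankZero

end
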